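import Mathlib
import HarnessLib
import Summits.HubbardSuperconductivity.HubbardSuperconductivity.Theorems.KLProgrammeRungMassesPlanar
import Summits.HubbardSuperconductivity.HubbardSuperconductivity.Theorems.KLProgrammeLatticeForwardBubble

/-!
# Route `KLProgramme` — crux K3, ENGINE child (`KLRegimeEngineV14`, stmt-HubbardSuperconductivity-19918), stub `stub_engine_step_values`
# (E2-v9) (m)/(neg): the sharp sign-blind radial mass ON THE MODEL CARRIER `MatsubaraIdx M × TorusSite 2 L`
# (cell gate-hubbard-kl, seat hubbard-kl-k3c2-p2 «thermal-bar induction n ≤ nScales β + 1»)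

The (m) line of (E2-v9) and p1 g7's `kled_sum_norm_pairWeight_le_mass` read the `Q = 0` slice mass as a LATTICE sum
`(βL²)⁻¹ Σ_{i,k} a(p_k)·F(ω_i² + e(p_k)²)/(ω_i² + e(p_k)²)` over the Matsubara frequencies and the torus momenta `p_k = 2πk/L` (frame band `e`,
doubly `2π`-periodic).  `…RadialMassPlanar` bounds the PLANAR version by `2π·(A₀π√2/d)·(½∫_{s>0}‖F‖/s + thermal)`; here the lattice sum is
compared with it by `klfl_matsubara_latticeAverage_norm_le_scale` (rate `32Λ_n·K/L`, `K` the sup-metric Lipschitz constant of the periodic integrand),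
exactly as `…LatticeForwardBubble` does for the forward bubble:

* `klrl_radial_eq_clamp_snd`, `klrl_div_radial_lipschitz_snd` — `e ↦ F(k²+e²)/(k²+e²)` is `8(4ℓ+16M_F)/Λ_n³`-Lipschitz (clamped radius);
* `klrl_lipschitz_double`, `klrl_integrand_eq_on_square`, `klrl_integrand_eq_zero_off_square` — bookkeeping against the cut-off planar weight `a·ψ`;
* **`klrl_lattice_radial_mass_le`** — `‖β⁻¹•Σ_i L⁻²•Σ_k a(p_k)·F(s_{i,k})/s_{i,k}‖ ≤ (2π)⁻²·(2π·(A₀π√2/d)·(½∫‖F‖/s + (1024/π)(4ℓ+16M_F)(π/β)/Λ_n))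
  + 32Λ_n·K/L`, `K = L_a·4M_F/Λ_n² + A₀·L_e·8(4ℓ+16M_F)/Λ_n³`;
* `klrl_lattice_realProfile_mass_le` — the same for a REAL profile `G` with `∫|G|/s ≤ m` (the form the four rung profiles of `…RungMassesPlanar` take).

Pure analysis; nothing about the model is asserted.
-/

noncomputable section

namespace Summit.HubbardSuperconductivity.HubbardSuperconductivity.Theorems.KLRegimeSplit

set_option linter.dupNamespace false -- summit = problem name (single-conjunct summit), D-0017

open Real Set Filter MeasureTheory Complex NNReal Literature.MathematicalPhysics.QuantumLattice
open Literature.MathematicalPhysics.QuantumLattice.BandSectorCounting Literature.Probability.LatticeModels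
open Summit.HubbardSuperconductivity.HubbardSuperconductivity.Theorems.PerturbedFermiCurve
open Summit.HubbardSuperconductivity.HubbardSuperconductivity.Theorems.KLProgrammeLegKernels
open Summit.HubbardSuperconductivity.HubbardSuperconductivity.Theorems.DispersionFlow

/-! ## §1 `e`-Lipschitz of the radial integrand `F(k² + e²)/(k² + e²)` -/

/-- Clamping the second variable does not change a profile supported in `s < r²`. -/
theorem klrl_radial_eq_clamp_snd {X : Type*} {H : ℝ → X} {r : ℝ} [Zero X] (hsupp : ∀ s, r ^ 2 ≤ s → H s = 0) (k e : ℝ) :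
    H (k ^ 2 + e ^ 2) = H (k ^ 2 + min (e ^ 2) (r ^ 2)) := by
  rcases le_total (e ^ 2) (r ^ 2) with h | h
  · rw [min_eq_left h]
  · rw [min_eq_right h, hsupp _ (by nlinarith [sq_nonneg k]), hsupp _ (by nlinarith [sq_nonneg k])]

/-- **`e ↦ F(k² + e²)/(k² + e²)` is `8(4ℓ + 16M_F)/Λ_n³`-Lipschitz** for a shell weight `F` (`‖F‖ ≤ M_F`, `‖F(s) − F(s′)‖ ≤ (ℓ/Λ_n²)|s − s′|`,
`F = 0` for `s ≤ (Λ_n/2)²` and `s ≥ (4Λ_n)²`). -/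
theorem klrl_div_radial_lipschitz_snd {F : ℝ → ℂ} {MF ℓ : ℝ} {n : ℕ} (hbd : ∀ s, ‖F s‖ ≤ MF)
    (hlip : ∀ s s', ‖F s - F s'‖ ≤ ℓ / klScale klE0 n ^ 2 * |s - s'|)
    (hin : ∀ s, s ≤ (klScale klE0 n / 2) ^ 2 → F s = 0) (hout : ∀ s, (4 * klScale klE0 n) ^ 2 ≤ s → F s = 0) (k e e' : ℝ) :
    ‖F (k ^ 2 + e ^ 2) / (((k ^ 2 + e ^ 2 : ℝ)) : ℂ) - F (k ^ 2 + e' ^ 2) / (((k ^ 2 + e' ^ 2 : ℝ)) : ℂ)‖ ≤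
      8 * (4 * ℓ + 16 * MF) / klScale klE0 n ^ 3 * |e - e'| := by
  set Λ := klScale klE0 n with hΛdef
  have hΛ : 0 < Λ := klth_klScale_pos n
  have hMF : 0 ≤ MF := (norm_nonneg _).trans (hbd 0)
  have hℓ : 0 ≤ ℓ := by
    have h := hlip 0 1
    have h0 : (0:ℝ) ≤ ‖F 0 - F 1‖ := norm_nonneg _
    norm_num at h
    by_contra hneg
    have : ℓ / Λ ^ 2 < 0 := div_neg_of_neg_of_pos (lt_of_not_ge hneg) (by positivity)
    linarith
  have hr₁ : 0 < Λ / 2 := by positivity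
  set Hc : ℝ → ℂ := fun s => F s / ((s : ℝ) : ℂ) with hHc
  have hHsupp : ∀ s, (4 * Λ) ^ 2 ≤ s → Hc s = 0 := fun s hs => by simp only [hHc, hout s hs, zero_div]
  have hHlip : ∀ s s', ‖Hc s - Hc s'‖ ≤ (ℓ / Λ ^ 2 / (Λ / 2) ^ 2 + MF / (Λ / 2) ^ 4) * |s - s'| :=
    fun s s' => klsp_div_lipschitz hlip hbd hin hr₁ s s'
  have hL : ℓ / Λ ^ 2 / (Λ / 2) ^ 2 + MF / (Λ / 2) ^ 4 = (4 * ℓ + 16 * MF) / Λ ^ 4 := by field_simp; ring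
  have h1 : Hc (k ^ 2 + e ^ 2) - Hc (k ^ 2 + e' ^ 2) =
      Hc (k ^ 2 + min (e ^ 2) ((4 * Λ) ^ 2)) - Hc (k ^ 2 + min (e' ^ 2) ((4 * Λ) ^ 2)) := by
    rw [klrl_radial_eq_clamp_snd hHsupp k e, klrl_radial_eq_clamp_snd hHsupp k e']
  show ‖Hc (k ^ 2 + e ^ 2) - Hc (k ^ 2 + e' ^ 2)‖ ≤ 8 * (4 * ℓ + 16 * MF) / Λ ^ 3 * |e - e'|
  rw [h1]
  refine (hHlip _ _).trans ?_
  rw [hL, add_sub_add_left_eq_sub]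
  have hmin := klrm_abs_min_sq_sub_le (by positivity : (0:ℝ) ≤ 4 * Λ) e e'
  have h0 : 0 ≤ (4 * ℓ + 16 * MF) / Λ ^ 4 := by positivity
  calc (4 * ℓ + 16 * MF) / Λ ^ 4 * |min (e ^ 2) ((4 * Λ) ^ 2) - min (e' ^ 2) ((4 * Λ) ^ 2)|
      ≤ (4 * ℓ + 16 * MF) / Λ ^ 4 * (2 * (4 * Λ) * |e - e'|) := mul_le_mul_of_nonneg_left hmin h0
    _ = 8 * (4 * ℓ + 16 * MF) / Λ ^ 3 * |e - e'| := by field_simp; ring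

/-- Sup of the radial integrand on the shell: `‖F(s)/s‖ ≤ 4M_F/Λ_n²`. -/
theorem klrl_div_norm_le {F : ℝ → ℂ} {MF : ℝ} {n : ℕ} (hbd : ∀ s, ‖F s‖ ≤ MF)
    (hin : ∀ s, s ≤ (klScale klE0 n / 2) ^ 2 → F s = 0) (s : ℝ) :
    ‖F s / ((s : ℝ) : ℂ)‖ ≤ 4 * MF / klScale klE0 n ^ 2 := by
  have hΛ := klth_klScale_pos n
  have h := klsp_div_norm_le hbd hin (by positivity : 0 < klScale klE0 n / 2) s
  refine h.trans (le_of_eq ?_)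
  field_simp
  ring

/-! ## §2 Bookkeeping: double products, the square cut-off -/

/-- Lipschitz constant of a product of two bounded Lipschitz functions (any pseudo-metric domain). -/
theorem klrl_lipschitz_double {X : Type*} [PseudoMetricSpace X] {u v : X → ℂ} {Mu Mv Lu Lv : ℝ}
    (hu : ∀ x, ‖u x‖ ≤ Mu) (hv : ∀ x, ‖v x‖ ≤ Mv)
    (hlu : ∀ x y, ‖u x - u y‖ ≤ Lu * dist x y) (hlv : ∀ x y, ‖v x - v y‖ ≤ Lv * dist x y) (x y : X) :
    ‖u x * v x - u y * v y‖ ≤ (Lu * Mv + Mu * Lv) * dist x y := by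
  have hMu : 0 ≤ Mu := (norm_nonneg _).trans (hu x)
  have hsplit : u x * v x - u y * v y = (u x - u y) * v x + u y * (v x - v y) := by ring
  rw [hsplit]
  have hLu : 0 ≤ Lu * dist x y := (norm_nonneg _).trans (hlu x y)
  have h1 : ‖(u x - u y) * v x‖ ≤ Lu * dist x y * Mv := by
    rw [norm_mul]; exact mul_le_mul (hlu x y) (hv x) (norm_nonneg _) hLu
  have h2 : ‖u y * (v x - v y)‖ ≤ Mu * (Lv * dist x y) := by
    rw [norm_mul]; exact mul_le_mul (hu y) (hlv x y) (norm_nonneg _) hMu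
  calc _ ≤ ‖(u x - u y) * v x‖ + ‖u y * (v x - v y)‖ := norm_add_le _ _
    _ ≤ Lu * dist x y * Mv + Mu * (Lv * dist x y) := add_le_add h1 h2
    _ = _ := by ring

section Square

variable {δ : (Fin 2 → ℝ) → ℝ} {μ zm : ℝ} {a : ℝ × ℝ → ℂ} {eb : ℝ × ℝ → ℝ} {F : ℝ → ℂ} {n : ℕ}

/-- **On the closed square the periodic integrand IS the cut-off planar integrand** (zone margin + `eb =` the frame band on the square). -/
theorem klrl_integrand_eq_on_square (hzm : 0 < zm) (heb : ∀ p ∈ Icc (-π) π ×ˢ Icc (-π) π, eb p = klfb_band δ μ p)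
    (hzone : ∀ p ∈ Icc (-π) π ×ˢ Icc (-π) π, |eb p| < 4 * klScale klE0 n → |p.1| ≤ π - 2 * zm ∧ |p.2| ≤ π - 2 * zm)
    (hout : ∀ s, (4 * klScale klE0 n) ^ 2 ≤ s → F s = 0) (k₀ : ℝ) {p : ℝ × ℝ} (hp : p ∈ Icc (-π) π ×ˢ Icc (-π) π) :
    a p * (F (k₀ ^ 2 + eb p ^ 2) / (((k₀ ^ 2 + eb p ^ 2 : ℝ)) : ℂ)) =
      (a p * (klfl_squareCut zm p : ℂ)) * (F (k₀ ^ 2 + klfb_band δ μ p ^ 2) / (((k₀ ^ 2 + klfb_band δ μ p ^ 2 : ℝ)) : ℂ)) := by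
  have hΛ := klth_klScale_pos n
  rw [← heb p hp]
  by_cases hF : F (k₀ ^ 2 + eb p ^ 2) = 0
  · simp only [hF, zero_div, mul_zero]
  · have hlt : k₀ ^ 2 + eb p ^ 2 < (4 * klScale klE0 n) ^ 2 := by
      by_contra hge
      exact hF (hout _ (not_lt.1 hge))
    have he : |eb p| < 4 * klScale klE0 n := abs_lt_of_sq_lt_sq (by nlinarith [sq_nonneg k₀]) (by positivity)
    obtain ⟨h1, h2⟩ := hzone p hp he
    rw [klfl_squareCut_eq_one hzm h1 h2, Complex.ofReal_one, mul_one]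

/-- Off the closed square the cut-off planar integrand vanishes. -/
theorem klrl_integrand_eq_zero_off_square (hzm : 0 < zm) (k₀ : ℝ) {p : ℝ × ℝ} (hp : p ∉ Icc (-π) π ×ˢ Icc (-π) π) :
    (a p * (klfl_squareCut zm p : ℂ)) * (F (k₀ ^ 2 + klfb_band δ μ p ^ 2) / (((k₀ ^ 2 + klfb_band δ μ p ^ 2 : ℝ)) : ℂ)) = 0 := by
  have hψ : klfl_squareCut zm p = 0 := by
    by_contra hne
    obtain ⟨h1, h2⟩ := klfl_abs_lt_of_squareCut_ne_zero hzm hne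
    exact hp ⟨abs_le.mp (by linarith), abs_le.mp (by linarith)⟩
  simp only [hψ, Complex.ofReal_zero, mul_zero, zero_mul]

end Square

/-! ## §3 The sharp sign-blind mass on the model carrier -/

section Lattice

variable {a' b' : ℝ} (B : BandBounds a' b') {δ : (Fin 2 → ℝ) → ℝ} (hδ1 : ContDiff ℝ 1 δ) {κ₀ κ₁ : ℝ}
  (hδ : ∀ k : Fin 2 → ℝ, (∀ i, |k i| ≤ π) → |δ k| ≤ κ₀)
  (hκ : ∀ k : Fin 2 → ℝ, (∀ i, |k i| ≤ π) → ‖fderiv ℝ δ k‖ ≤ κ₁) (hκ₁ : κ₁ < B.Dtmin)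

include B hδ1 hδ hκ hκ₁ in
/-- **THE SHARP SIGN-BLIND RADIAL MASS ON `MatsubaraIdx M × TorusSite 2 L`.**  Data: the frame (p4's hypotheses, margin window at radius `4Λ_n`);
a doubly `2π`-periodic continuous weight `a` (`‖a‖ ≤ A₀`, `L_a`-Lipschitz, sup metric); the periodic frame band `eb` (continuous, `L_e`-Lipschitz,
`= klfb_band δ μ` on the closed square, zone margin `zm > 0`); a shell weight `F` (`‖F‖ ≤ M_F`, `‖F(s) − F(s′)‖ ≤ (ℓ/Λ_n²)|s−s′|`, `F = 0` for
`s ≤ (Λ_n/2)²` and `s ≥ (4Λ_n)²`); `n ≤ n_β + 1`, `M ≥ 4Λ_nβ/(2π) + 1`.  Then, with `K := L_a·4M_F/Λ_n² + A₀·(8(4ℓ+16M_F)/Λ_n³)·L_e`: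
`‖β⁻¹•Σ_i L⁻²•Σ_k a(p_k)·F(ω_i² + eb(p_k)²)/(ω_i² + eb(p_k)²)‖ ≤ (2π)⁻²·(2π·(A₀π√2/(Dt_min−κ₁))·(½∫_{s>0}‖F‖/s + (1024/π)(4ℓ+16M_F)(π/β)/Λ_n))
+ 32Λ_n·K/L`. -/
theorem klrl_lattice_radial_mass_le
    {a : ℝ × ℝ → ℂ} (ha : Continuous a) (ha1 : ∀ x y, a (x + 2 * π, y) = a (x, y)) (ha2 : ∀ x y, a (x, y + 2 * π) = a (x, y))
    {A₀ La : ℝ} (hA0 : ∀ p, ‖a p‖ ≤ A₀) (hLa : ∀ p q, ‖a p - a q‖ ≤ La * dist p q)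
    {eb : ℝ × ℝ → ℝ} (hebc : Continuous eb) (heb1 : ∀ x y, eb (x + 2 * π, y) = eb (x, y)) (heb2 : ∀ x y, eb (x, y + 2 * π) = eb (x, y))
    {Le : ℝ} (hLe : ∀ p q, |eb p - eb q| ≤ Le * dist p q) {μ : ℝ} (heb : ∀ p ∈ Icc (-π) π ×ˢ Icc (-π) π, eb p = klfb_band δ μ p)
    {zm : ℝ} (hzm : 0 < zm) {n : ℕ}
    (hzone : ∀ p ∈ Icc (-π) π ×ˢ Icc (-π) π, |eb p| < 4 * klScale klE0 n → |p.1| ≤ π - 2 * zm ∧ |p.2| ≤ π - 2 * zm)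
    {F : ℝ → ℂ} {MF ℓ : ℝ} (hbd : ∀ s, ‖F s‖ ≤ MF) (hlip : ∀ s s', ‖F s - F s'‖ ≤ ℓ / klScale klE0 n ^ 2 * |s - s'|)
    (hin : ∀ s, s ≤ (klScale klE0 n / 2) ^ 2 → F s = 0) (hout : ∀ s, (4 * klScale klE0 n) ^ 2 ≤ s → F s = 0)
    (hlo : a' < μ - 4 * klScale klE0 n - κ₀) (hhi : μ + 4 * klScale klE0 n + κ₀ < b')
    {β : ℝ} (hβ : klBetaMin ≤ β) (hn : n ≤ nScales β + 1) {M : ℕ}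
    (hM : β * (4 * klScale klE0 n) / (2 * Real.pi) + 1 ≤ M) (L : ℕ) [NeZero L] :
    ‖β⁻¹ • ∑ i : MatsubaraIdx M, ((L ^ 2 : ℕ) : ℝ)⁻¹ • ∑ k : TorusSite 2 L,
        a (latticeMomentum L k 0, latticeMomentum L k 1) *
          (F (matsubaraFreq β M i ^ 2 + eb (latticeMomentum L k 0, latticeMomentum L k 1) ^ 2) /
            (((matsubaraFreq β M i ^ 2 + eb (latticeMomentum L k 0, latticeMomentum L k 1) ^ 2 : ℝ)) : ℂ))‖ ≤
      ((2 * π) ^ 2)⁻¹ *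
          (2 * Real.pi * (A₀ * (Real.pi * Real.sqrt 2 / (B.Dtmin - κ₁)) *
            (1 / 2 * (∫ s in Ioi (0 : ℝ), ‖F s‖ / s) + 1024 / Real.pi * (4 * ℓ + 16 * MF) * ((Real.pi / β) / klScale klE0 n)))) +
        32 * klScale klE0 n *
            (La * (4 * MF / klScale klE0 n ^ 2) + A₀ * (8 * (4 * ℓ + 16 * MF) / klScale klE0 n ^ 3) * Le) / L := by
  have hΛ := klth_klScale_pos n
  have hA0' : 0 ≤ A₀ := (norm_nonneg _).trans (hA0 0)
  have hMF : 0 ≤ MF := (norm_nonneg _).trans (hbd 0)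
  have hLa0 : 0 ≤ La := by
    have h := hLa (1, 0) (0, 0)
    have hd : (0 : ℝ) < dist ((1 : ℝ), (0 : ℝ)) ((0 : ℝ), (0 : ℝ)) := by rw [Prod.dist_eq]; simp
    exact nonneg_of_mul_nonneg_left ((norm_nonneg _).trans h) hd
  have hLe0 : 0 ≤ Le := by
    have h := hLe (1, 0) (0, 0)
    have hd : (0 : ℝ) < dist ((1 : ℝ), (0 : ℝ)) ((0 : ℝ), (0 : ℝ)) := by rw [Prod.dist_eq]; simp
    exact nonneg_of_mul_nonneg_left ((abs_nonneg _).trans h) hd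
  have hℓ : 0 ≤ ℓ := by
    have h := hlip 0 1
    have h0 : (0:ℝ) ≤ ‖F 0 - F 1‖ := norm_nonneg _
    norm_num at h
    by_contra hneg
    have : ℓ / klScale klE0 n ^ 2 < 0 := div_neg_of_neg_of_pos (lt_of_not_ge hneg) (by positivity)
    linarith
  have hr₁ : 0 < klScale klE0 n / 2 := by positivity
  -- the planar weight `A = a·ψ`
  set A : ℝ × ℝ → ℂ := fun p => a p * (klfl_squareCut zm p : ℂ) with hAdef
  have hψbd : ∀ p, ‖(klfl_squareCut zm p : ℂ)‖ ≤ 1 := fun p => by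
    rw [Complex.norm_real, Real.norm_of_nonneg (klfl_squareCut_mem zm p).1]; exact (klfl_squareCut_mem zm p).2
  have hAc : Continuous A := ha.mul (Complex.continuous_ofReal.comp (klfl_continuous_squareCut zm))
  have hAsupp : ∀ p : ℝ × ℝ, A p ≠ 0 → |p.1| < π ∧ |p.2| < π := by
    intro p hp
    have hψ : klfl_squareCut zm p ≠ 0 := fun h0 => hp (by simp only [hAdef, h0, Complex.ofReal_zero, mul_zero])
    obtain ⟨h1, h2⟩ := klfl_abs_lt_of_squareCut_ne_zero hzm hψ
    exact ⟨by linarith, by linarith⟩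
  have hAbd : ∀ p, ‖A p‖ ≤ A₀ := fun p => by
    simp only [hAdef]; rw [norm_mul]
    calc ‖a p‖ * ‖(klfl_squareCut zm p : ℂ)‖ ≤ A₀ * 1 := mul_le_mul (hA0 p) (hψbd p) (norm_nonneg _) hA0'
      _ = A₀ := mul_one _
  -- the planar bound
  have hB := klrp_planar_mass_norm_le B hδ1 hδ hκ hκ₁ hAc hAsupp hAbd hbd hlip hin hout hlo hhi hβ hn hM
  -- the periodic family and its properties
  set Fi : MatsubaraIdx M → ℝ × ℝ → ℂ := fun i p =>
    a p * (F (matsubaraFreq β M i ^ 2 + eb p ^ 2) / (((matsubaraFreq β M i ^ 2 + eb p ^ 2 : ℝ)) : ℂ)) with hFidef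
  have hHc : Continuous fun s : ℝ => F s / ((s : ℝ) : ℂ) := klrp_continuous_div hlip hbd hin hr₁
  have hFc : ∀ i, Continuous (Fi i) := fun i =>
    ha.mul (hHc.comp (continuous_const.add (hebc.pow 2)))
  have hF1 : ∀ i x y, Fi i (x + 2 * π, y) = Fi i (x, y) := fun i x y => by simp only [hFidef, ha1, heb1]
  have hF2 : ∀ i x y, Fi i (x, y + 2 * π) = Fi i (x, y) := fun i x y => by simp only [hFidef, ha2, heb2]
  set K : ℝ := La * (4 * MF / klScale klE0 n ^ 2) + A₀ * (8 * (4 * ℓ + 16 * MF) / klScale klE0 n ^ 3) * Le with hKdef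
  have hK0 : 0 ≤ K := by rw [hKdef]; positivity
  have hFlip' : ∀ i (p q : ℝ × ℝ), ‖Fi i p - Fi i q‖ ≤ (K.toNNReal : ℝ) * dist p q := by
    intro i p q
    rw [Real.coe_toNNReal _ hK0]
    have hv : ∀ p q : ℝ × ℝ, ‖F (matsubaraFreq β M i ^ 2 + eb p ^ 2) / (((matsubaraFreq β M i ^ 2 + eb p ^ 2 : ℝ)) : ℂ) -
        F (matsubaraFreq β M i ^ 2 + eb q ^ 2) / (((matsubaraFreq β M i ^ 2 + eb q ^ 2 : ℝ)) : ℂ)‖ ≤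
        8 * (4 * ℓ + 16 * MF) / klScale klE0 n ^ 3 * Le * dist p q :=
      fun p q => (klrl_div_radial_lipschitz_snd hbd hlip hin hout (matsubaraFreq β M i) (eb p) (eb q)).trans (by
        rw [mul_assoc]; exact mul_le_mul_of_nonneg_left (hLe p q) (by positivity))
    have h := klrl_lipschitz_double (u := a)
      (v := fun p => F (matsubaraFreq β M i ^ 2 + eb p ^ 2) / (((matsubaraFreq β M i ^ 2 + eb p ^ 2 : ℝ)) : ℂ))
      hA0 (fun p => klrl_div_norm_le hbd hin _) hLa hv p q
    refine h.trans (le_of_eq ?_)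
    rw [hKdef]; ring
  have hFh : ∀ i, ∀ p ∈ Icc (-π) π ×ˢ Icc (-π) π, Fi i p =
      A p * (F (matsubaraFreq β M i ^ 2 + klfb_band δ μ p ^ 2) / (((matsubaraFreq β M i ^ 2 + klfb_band δ μ p ^ 2 : ℝ)) : ℂ)) :=
    fun i p hp => klrl_integrand_eq_on_square hzm heb hzone hout (matsubaraFreq β M i) hp
  have hh0 : ∀ i, ∀ p ∉ Icc (-π) π ×ˢ Icc (-π) π,
      A p * (F (matsubaraFreq β M i ^ 2 + klfb_band δ μ p ^ 2) / (((matsubaraFreq β M i ^ 2 + klfb_band δ μ p ^ 2 : ℝ)) : ℂ)) = 0 :=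
    fun i p hp => klrl_integrand_eq_zero_off_square hzm (matsubaraFreq β M i) hp
  have hzero : ∀ i, 4 * klScale klE0 n ≤ |matsubaraFreq β M i| → ∀ p, Fi i p = 0 := by
    intro i hi p
    simp only [hFidef]
    rw [hout _ (by nlinarith [sq_abs (matsubaraFreq β M i), sq_nonneg (eb p), abs_nonneg (matsubaraFreq β M i), hΛ.le]),
      zero_div, mul_zero]
  have h := klfl_matsubara_latticeAverage_norm_le_scale (F := Fi)
    (h := fun i p => A p * (F (matsubaraFreq β M i ^ 2 + klfb_band δ μ p ^ 2) / (((matsubaraFreq β M i ^ 2 + klfb_band δ μ p ^ 2 : ℝ)) : ℂ)))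
    hβ hn hFc hF1 hF2 hFlip' hFh hh0 hzero hB L
  rw [Real.coe_toNNReal _ hK0] at h
  exact h

include B hδ1 hδ hκ hκ₁ in
/-- **The same for a REAL profile** `G` (`|G| ≤ M_F`, `|G(s) − G(s′)| ≤ (ℓ/Λ_n²)|s−s′|`, support in the shell, `∫_{s>0}|G|/s ≤ m`) — the form the four rung
profiles of `…RungMassesPlanar` take (same slice `½m = ½log 16`, partners `⅛log 4`, transfer `¼log 4`). -/
theorem klrl_lattice_realProfile_mass_le
    {a : ℝ × ℝ → ℂ} (ha : Continuous a) (ha1 : ∀ x y, a (x + 2 * π, y) = a (x, y)) (ha2 : ∀ x y, a (x, y + 2 * π) = a (x, y))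
    {A₀ La : ℝ} (hA0 : ∀ p, ‖a p‖ ≤ A₀) (hLa : ∀ p q, ‖a p - a q‖ ≤ La * dist p q)
    {eb : ℝ × ℝ → ℝ} (hebc : Continuous eb) (heb1 : ∀ x y, eb (x + 2 * π, y) = eb (x, y)) (heb2 : ∀ x y, eb (x, y + 2 * π) = eb (x, y))
    {Le : ℝ} (hLe : ∀ p q, |eb p - eb q| ≤ Le * dist p q) {μ : ℝ} (heb : ∀ p ∈ Icc (-π) π ×ˢ Icc (-π) π, eb p = klfb_band δ μ p)
    {zm : ℝ} (hzm : 0 < zm) {n : ℕ}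
    (hzone : ∀ p ∈ Icc (-π) π ×ˢ Icc (-π) π, |eb p| < 4 * klScale klE0 n → |p.1| ≤ π - 2 * zm ∧ |p.2| ≤ π - 2 * zm)
    {G : ℝ → ℝ} {MF ℓ m : ℝ} (hbd : ∀ s, |G s| ≤ MF) (hlip : ∀ s s', |G s - G s'| ≤ ℓ / klScale klE0 n ^ 2 * |s - s'|)
    (hin : ∀ s, s ≤ (klScale klE0 n / 2) ^ 2 → G s = 0) (hout : ∀ s, (4 * klScale klE0 n) ^ 2 ≤ s → G s = 0)
    (hm : ∫ s in Ioi (0 : ℝ), |G s| / s ≤ m)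
    (hlo : a' < μ - 4 * klScale klE0 n - κ₀) (hhi : μ + 4 * klScale klE0 n + κ₀ < b')
    {β : ℝ} (hβ : klBetaMin ≤ β) (hn : n ≤ nScales β + 1) {M : ℕ}
    (hM : β * (4 * klScale klE0 n) / (2 * Real.pi) + 1 ≤ M) (L : ℕ) [NeZero L] :
    ‖β⁻¹ • ∑ i : MatsubaraIdx M, ((L ^ 2 : ℕ) : ℝ)⁻¹ • ∑ k : TorusSite 2 L,
        a (latticeMomentum L k 0, latticeMomentum L k 1) *
          (((G (matsubaraFreq β M i ^ 2 + eb (latticeMomentum L k 0, latticeMomentum L k 1) ^ 2) : ℝ) : ℂ) /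
            (((matsubaraFreq β M i ^ 2 + eb (latticeMomentum L k 0, latticeMomentum L k 1) ^ 2 : ℝ)) : ℂ))‖ ≤
      ((2 * π) ^ 2)⁻¹ *
          (2 * Real.pi * (A₀ * (Real.pi * Real.sqrt 2 / (B.Dtmin - κ₁)) *
            (1 / 2 * m + 1024 / Real.pi * (4 * ℓ + 16 * MF) * ((Real.pi / β) / klScale klE0 n)))) +
        32 * klScale klE0 n *
            (La * (4 * MF / klScale klE0 n ^ 2) + A₀ * (8 * (4 * ℓ + 16 * MF) / klScale klE0 n ^ 3) * Le) / L := by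
  set Fc : ℝ → ℂ := fun s => ((G s : ℝ) : ℂ) with hFc
  have hFbd : ∀ s, ‖Fc s‖ ≤ MF := fun s => by rw [hFc]; simp only [Complex.norm_real, Real.norm_eq_abs]; exact hbd s
  have hFlip : ∀ s s', ‖Fc s - Fc s'‖ ≤ ℓ / klScale klE0 n ^ 2 * |s - s'| := fun s s' => by
    simp only [hFc, ← Complex.ofReal_sub, Complex.norm_real, Real.norm_eq_abs]; exact hlip s s'
  have hFin : ∀ s, s ≤ (klScale klE0 n / 2) ^ 2 → Fc s = 0 := fun s hs => by simp only [hFc, hin s hs, Complex.ofReal_zero]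
  have hFout : ∀ s, (4 * klScale klE0 n) ^ 2 ≤ s → Fc s = 0 := fun s hs => by simp only [hFc, hout s hs, Complex.ofReal_zero]
  have hmain := klrl_lattice_radial_mass_le B hδ1 hδ hκ hκ₁ ha ha1 ha2 hA0 hLa hebc heb1 heb2 hLe heb hzm hzone hFbd hFlip hFin hFout
    hlo hhi hβ hn hM L
  have hmass : ∫ s in Ioi (0 : ℝ), ‖Fc s‖ / s ≤ m := by
    refine le_trans (le_of_eq (setIntegral_congr_fun measurableSet_Ioi fun s _ => ?_)) hm
    simp only [hFc, Complex.norm_real, Real.norm_eq_abs]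
  have hΛ := klth_klScale_pos n
  have hd : 0 < B.Dtmin - κ₁ := by linarith
  have hA0' : 0 ≤ A₀ := (norm_nonneg _).trans (hA0 0)
  have hBW : 0 ≤ A₀ * (Real.pi * Real.sqrt 2 / (B.Dtmin - κ₁)) := by positivity
  refine hmain.trans (add_le_add (mul_le_mul_of_nonneg_left (mul_le_mul_of_nonneg_left (mul_le_mul_of_nonneg_left
    (by linarith) hBW) (by positivity)) (by positivity)) le_rfl)

end Lattice

end Summit.HubbardSuperconductivity.HubbardSuperconductivity.Theorems.KLRegimeSplit

end
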